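import Mathlib.Algebra.Lie.OfAssociative
import Mathlib.Algebra.Module.LinearMap.End
import Mathlib.LinearAlgebra.Matrix.ConjTranspose
import Mathlib.Data.Complex.Basic
import Mathlib.Data.Matrix.Basis
import Mathlib.Tactic.NoncommRing
import Mathlib.Tactic.FinCases
import HarnessLib

/-!
# Operator calculus for a pair of commuting `𝔤𝔩₂(ℂ)`-actions (companion of `Sl2PairStepDown`)

Topic `Algebra/Lie`; theorems only (no definition, no structure, no named fact; the matrix units are a
scoped notation `Matrix.single a b (1 : ℂ) = Matrix.single a b (1 : ℂ)`). For complex-linear Lie algebra maps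
`L, R : 𝔤𝔩₂(ℂ) → End V` (the two factors `𝔤𝔩₂(ℂ) ⊗_ℝ ℂ ≅ 𝔤𝔩₂(ℂ) × 𝔤𝔩₂(ℂ)` of `𝔤𝔩₂(ℂ)` viewed as a
real Lie algebra; Knapp, *Lie Groups Beyond an Introduction* (2002), §VI.1):

* the brackets of the matrix units `E₀₀, E₁₁, E₀₁, E₁₀` (`lie_h_e`, `lie_h_f`, `lie_e_f`, `lie_d_d`,
  `lie_d0_e`, `lie_d0_f`), `1 = E₀₀ + E₁₁`, `E_{ab}ᵀ = E_{ba}`;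
* `gl2_casimir_sl2` — **the Casimir element in `𝔰𝔩₂` form**: if `L 1 = S` and
  `∑_{ab} L(E_{ab}) L(E_{ba}) = c`, then `4 L(E₁₀)L(E₀₁) + 2 L(E₀₀ - E₁₁) + L(E₀₀ - E₁₁)² = 2c - S²`
  (the hypothesis shape of `Literature.Algebra.Lie.Sl2Pair.stepDown`);
* `diag_mem_of_skew` — a subspace stable under the **twisted diagonal** `D(Y) = L(Y) - R(Yᵀ)` for
  skew-Hermitian `Y` (the complexified action of `𝔲(2)`: `Ȳ = -Yᵀ`) is stable under `D(Y)` for all `Y`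
  (`Y = ½(Y - Yᴴ) - (i/2)(i(Y + Yᴴ))`);
* `lie_restrict_eq` — restricting a commutator identity `AB - BA = C` to a stable subspace, as a Lie
  bracket in `End F` (to feed Mathlib's `IsSl2Triple` on finite-dimensional stable subspaces).

Consumer: the integral pairing of Harish-Chandra parameters at a complex place
(`Summits/Langlands/…/IrreducibilityBySelfDualityRegularTwistCMPairingCore.lean`).

## References

* A. W. Knapp, *Lie Groups Beyond an Introduction*, 2nd ed. (2002), §I.8, §VI.1. [Knapp2002]
-/

-- Mathlib idiom (Mathlib/Algebra/Lie/OfAssociative.lean): commutator brackets on matrix algebras and on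
-- `Module.End` (as in `Literature.NumberTheory.Automorphic.HarishChandraGL`).
attribute [local instance 100] LieRing.ofAssociativeRing

noncomputable section

open scoped Matrix

namespace Literature.Algebra.Lie.GL2Pair

/-! ### Matrix units of `𝔤𝔩₂` -/

/-- `[E₀₀ - E₁₁, E₀₁] = 2 E₀₁` in `𝔤𝔩₂(ℂ)`. [folklore] -/
theorem lie_h_e :
    ⁅(Matrix.single 0 0 (1 : ℂ) - Matrix.single 1 1 (1 : ℂ) : Matrix (Fin 2) (Fin 2) ℂ), (Matrix.single 0 1 (1 : ℂ) : Matrix (Fin 2) (Fin 2) ℂ)⁆ = Matrix.single 0 1 (1 : ℂ) + Matrix.single 0 1 (1 : ℂ) := by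
  ext i j
  fin_cases i <;> fin_cases j <;>
    simp [Ring.lie_def, Matrix.mul_apply, Matrix.single, Matrix.sub_apply]

/-- `[E₀₀ - E₁₁, E₁₀] = -2 E₁₀` in `𝔤𝔩₂(ℂ)`. [folklore] -/
theorem lie_h_f :
    ⁅(Matrix.single 0 0 (1 : ℂ) - Matrix.single 1 1 (1 : ℂ) : Matrix (Fin 2) (Fin 2) ℂ), (Matrix.single 1 0 (1 : ℂ) : Matrix (Fin 2) (Fin 2) ℂ)⁆ = -(Matrix.single 1 0 (1 : ℂ) + Matrix.single 1 0 (1 : ℂ)) := by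
  ext i j
  fin_cases i <;> fin_cases j <;>
    simp [Ring.lie_def, Matrix.mul_apply, Matrix.single, Matrix.sub_apply]
  norm_num

/-- `[E₀₁, E₁₀] = E₀₀ - E₁₁` in `𝔤𝔩₂(ℂ)`. [folklore] -/
theorem lie_e_f :
    ⁅(Matrix.single 0 1 (1 : ℂ) : Matrix (Fin 2) (Fin 2) ℂ), (Matrix.single 1 0 (1 : ℂ) : Matrix (Fin 2) (Fin 2) ℂ)⁆ = Matrix.single 0 0 (1 : ℂ) - Matrix.single 1 1 (1 : ℂ) := by
  ext i j
  fin_cases i <;> fin_cases j <;>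
    simp [Ring.lie_def, Matrix.mul_apply, Matrix.single, Matrix.sub_apply]

/-- `[E₀₀, E₁₁] = 0`. [folklore] -/
theorem lie_d_d : ⁅(Matrix.single 0 0 (1 : ℂ) : Matrix (Fin 2) (Fin 2) ℂ), (Matrix.single 1 1 (1 : ℂ) : Matrix (Fin 2) (Fin 2) ℂ)⁆ = 0 := by
  ext i j
  fin_cases i <;> fin_cases j <;>
    simp [Ring.lie_def, Matrix.mul_apply, Matrix.single]

/-- `[E₀₀, E₀₁] = E₀₁`. [folklore] -/
theorem lie_d0_e :
    ⁅(Matrix.single 0 0 (1 : ℂ) : Matrix (Fin 2) (Fin 2) ℂ), (Matrix.single 0 1 (1 : ℂ) : Matrix (Fin 2) (Fin 2) ℂ)⁆ = Matrix.single 0 1 (1 : ℂ) := by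
  ext i j
  fin_cases i <;> fin_cases j <;>
    simp [Ring.lie_def, Matrix.mul_apply, Matrix.single]

/-- `[E₀₀, E₁₀] = -E₁₀`. [folklore] -/
theorem lie_d0_f :
    ⁅(Matrix.single 0 0 (1 : ℂ) : Matrix (Fin 2) (Fin 2) ℂ), (Matrix.single 1 0 (1 : ℂ) : Matrix (Fin 2) (Fin 2) ℂ)⁆ = -Matrix.single 1 0 (1 : ℂ) := by
  ext i j
  fin_cases i <;> fin_cases j <;>
    simp [Ring.lie_def, Matrix.mul_apply, Matrix.single]

/-- `1 = E₀₀ + E₁₁` in `𝔤𝔩₂(ℂ)`. [folklore] -/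
theorem one_eq_single_add_single :
    (1 : Matrix (Fin 2) (Fin 2) ℂ) = Matrix.single 0 0 (1 : ℂ) + Matrix.single 1 1 (1 : ℂ) := by
  ext i j
  fin_cases i <;> fin_cases j <;> simp [Matrix.single]

/-- Transposes of matrix units: `E_{ab}ᵀ = E_{ba}`. [folklore] -/
theorem single_one_transpose (a b : Fin 2) :
    (Matrix.single a b (1 : ℂ) : Matrix (Fin 2) (Fin 2) ℂ)ᵀ = Matrix.single b a (1 : ℂ) := by
  ext i j
  simp only [Matrix.transpose_apply, Matrix.single_apply]
  by_cases h1 : a = j <;> by_cases h2 : b = i <;> simp [h1, h2, and_comm]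

variable {V : Type*} [AddCommGroup V] [Module ℂ V]

/-! ### Brackets and Casimir of one factor -/

/-- `L[X, Y] = L X L Y - L Y L X` for a Lie algebra map into `End V`. [folklore] -/
theorem gl2_map_lie (L : Matrix (Fin 2) (Fin 2) ℂ →ₗ⁅ℂ⁆ Module.End ℂ V) (X Y : Matrix (Fin 2) (Fin 2) ℂ) :
    L X * L Y - L Y * L X = L ⁅X, Y⁆ := by
  rw [← Ring.lie_def, LieHom.map_lie]

/-- **The Casimir of one factor in `𝔰𝔩₂` form.** If `L 1 = S` and `∑ L(E_{ab}) L(E_{ba}) = c`, then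
for `e = L E₀₁`, `f = L E₁₀`, `h = L(E₀₀ - E₁₁)`: `4fe + 2h + h² = 2c - S²`. [folklore] -/
theorem gl2_casimir_sl2 (L : Matrix (Fin 2) (Fin 2) ℂ →ₗ⁅ℂ⁆ Module.End ℂ V) {S c : ℂ}
    (hZ : L 1 = S • (1 : Module.End ℂ V))
    (hC : ∑ a : Fin 2, ∑ b : Fin 2, L (Matrix.single a b 1) * L (Matrix.single b a 1) =
      c • (1 : Module.End ℂ V)) :
    4 * (L (Matrix.single 1 0 (1 : ℂ)) * L (Matrix.single 0 1 (1 : ℂ))) + 2 * L (Matrix.single 0 0 (1 : ℂ) - Matrix.single 1 1 (1 : ℂ)) + L (Matrix.single 0 0 (1 : ℂ) - Matrix.single 1 1 (1 : ℂ)) * L (Matrix.single 0 0 (1 : ℂ) - Matrix.single 1 1 (1 : ℂ)) =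
      (2 * (c - S ^ 2 / 2)) • (1 : Module.End ℂ V) := by
  simp only [Fin.sum_univ_two] at hC
  change L (Matrix.single 0 0 (1 : ℂ)) * L (Matrix.single 0 0 (1 : ℂ)) + L (Matrix.single 0 1 (1 : ℂ)) * L (Matrix.single 1 0 (1 : ℂ)) +
    (L (Matrix.single 1 0 (1 : ℂ)) * L (Matrix.single 0 1 (1 : ℂ)) + L (Matrix.single 1 1 (1 : ℂ)) * L (Matrix.single 1 1 (1 : ℂ))) = c • 1 at hC
  have hef : L (Matrix.single 0 1 (1 : ℂ)) * L (Matrix.single 1 0 (1 : ℂ)) - L (Matrix.single 1 0 (1 : ℂ)) * L (Matrix.single 0 1 (1 : ℂ)) - (L (Matrix.single 0 0 (1 : ℂ)) - L (Matrix.single 1 1 (1 : ℂ))) = 0 := by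
    rw [gl2_map_lie, lie_e_f, map_sub, sub_self]
  have hZ' : L (Matrix.single 0 0 (1 : ℂ)) + L (Matrix.single 1 1 (1 : ℂ)) = S • (1 : Module.End ℂ V) := by
    rw [← map_add, ← one_eq_single_add_single, hZ]
  rw [map_sub]
  have key : 4 * (L (Matrix.single 1 0 (1 : ℂ)) * L (Matrix.single 0 1 (1 : ℂ))) + 2 * (L (Matrix.single 0 0 (1 : ℂ)) - L (Matrix.single 1 1 (1 : ℂ))) +
      (L (Matrix.single 0 0 (1 : ℂ)) - L (Matrix.single 1 1 (1 : ℂ))) * (L (Matrix.single 0 0 (1 : ℂ)) - L (Matrix.single 1 1 (1 : ℂ))) =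
      2 * (L (Matrix.single 0 0 (1 : ℂ)) * L (Matrix.single 0 0 (1 : ℂ)) + L (Matrix.single 0 1 (1 : ℂ)) * L (Matrix.single 1 0 (1 : ℂ)) +
        (L (Matrix.single 1 0 (1 : ℂ)) * L (Matrix.single 0 1 (1 : ℂ)) + L (Matrix.single 1 1 (1 : ℂ)) * L (Matrix.single 1 1 (1 : ℂ)))) -
      2 * (L (Matrix.single 0 1 (1 : ℂ)) * L (Matrix.single 1 0 (1 : ℂ)) - L (Matrix.single 1 0 (1 : ℂ)) * L (Matrix.single 0 1 (1 : ℂ)) - (L (Matrix.single 0 0 (1 : ℂ)) - L (Matrix.single 1 1 (1 : ℂ)))) -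
      (L (Matrix.single 0 0 (1 : ℂ)) + L (Matrix.single 1 1 (1 : ℂ))) * (L (Matrix.single 0 0 (1 : ℂ)) + L (Matrix.single 1 1 (1 : ℂ))) := by
    noncomm_ring
  have h2 : (2 : Module.End ℂ V) = (2 : ℂ) • (1 : Module.End ℂ V) := by
    rw [← map_ofNat (algebraMap ℂ (Module.End ℂ V)) 2, Algebra.algebraMap_eq_smul_one]
  rw [key, hC, hef, hZ', mul_zero, sub_zero, h2, smul_mul_smul_comm, one_mul,
    smul_mul_smul_comm, one_mul, ← sub_smul]
  congr 1; ring

/-! ### The twisted diagonal `D(Y) = L(Y) - R(Yᵀ)` -/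

/-- The twisted diagonal is stable on a subspace stable under its values on skew-Hermitian matrices:
`Y = ½(Y - Yᴴ) - (i/2) · (i (Y + Yᴴ))` with both `Y - Yᴴ` and `i(Y + Yᴴ)` skew-Hermitian. [folklore] -/
theorem diag_mem_of_skew (L R : Matrix (Fin 2) (Fin 2) ℂ →ₗ⁅ℂ⁆ Module.End ℂ V) {F : Submodule ℂ V}
    (hF : ∀ Y : Matrix (Fin 2) (Fin 2) ℂ, Yᴴ = -Y → ∀ x ∈ F, (L Y - R Yᵀ) x ∈ F)
    (Y : Matrix (Fin 2) (Fin 2) ℂ) {x : V} (hx : x ∈ F) : (L Y - R Yᵀ) x ∈ F := by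
  have h1 : (Y - Yᴴ)ᴴ = -(Y - Yᴴ) := by
    rw [Matrix.conjTranspose_sub, Matrix.conjTranspose_conjTranspose, neg_sub]
  have h2 : (Complex.I • (Y + Yᴴ))ᴴ = -(Complex.I • (Y + Yᴴ)) := by
    rw [Matrix.conjTranspose_smul, Matrix.conjTranspose_add, Matrix.conjTranspose_conjTranspose,
      Complex.star_def, Complex.conj_I, neg_smul, add_comm]
  have hY : Y = (1 / 2 : ℂ) • (Y - Yᴴ) + (-(Complex.I / 2)) • (Complex.I • (Y + Yᴴ)) := by
    rw [smul_smul, show -(Complex.I / 2) * Complex.I = 1 / 2 by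
      rw [neg_mul, div_mul_eq_mul_div, Complex.I_mul_I]; ring, ← smul_add, sub_add_add_cancel,
      ← two_smul ℂ Y, smul_smul]
    norm_num
  have hlin : ∀ (c : ℂ) (Z : Matrix (Fin 2) (Fin 2) ℂ),
      (L (c • Z) - R (c • Z)ᵀ) x = c • (L Z - R Zᵀ) x := by
    intro c Z
    rw [Matrix.transpose_smul, map_smul, map_smul, LinearMap.sub_apply, LinearMap.sub_apply,
      LinearMap.smul_apply, LinearMap.smul_apply, smul_sub]
  have hadd : ∀ Z W : Matrix (Fin 2) (Fin 2) ℂ,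
      (L (Z + W) - R (Z + W)ᵀ) x = (L Z - R Zᵀ) x + (L W - R Wᵀ) x := by
    intro Z W
    rw [Matrix.transpose_add, map_add, map_add]
    simp only [LinearMap.sub_apply, LinearMap.add_apply]
    abel
  rw [hY, hadd, hlin, hlin]
  exact F.add_mem (F.smul_mem _ (hF _ h1 x hx)) (F.smul_mem _ (hF _ h2 x hx))

/-- Restriction of a commutator identity `AB - BA = C` of operators preserving a subspace to that
subspace, as a Lie bracket in `End F`. [folklore] -/
theorem lie_restrict_eq {F : Submodule ℂ V} (A B C : Module.End ℂ V) (hA : ∀ x ∈ F, A x ∈ F)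
    (hB : ∀ x ∈ F, B x ∈ F) (hC : ∀ x ∈ F, C x ∈ F) (hABC : A * B - B * A = C) :
    ⁅A.restrict hA, B.restrict hB⁆ = C.restrict hC := by
  ext x
  have t := LinearMap.congr_fun hABC (x : V)
  simp only [LinearMap.sub_apply, Module.End.mul_apply] at t
  simp [Ring.lie_def, LinearMap.restrict_apply, t]

end Literature.Algebra.Lie.GL2Pair

end
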